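import Summits.ResolutionOfSingularities.ResolutionOfSingularities.Theorems.PAlterationPialtAtomsOpenRange
import Literature.AlgebraicGeometry.Resolution.ProperModelsPatchingOfResolution
import Literature.AlgebraicGeometry.Resolution.ProperModelsFunctionField
import Literature.AlgebraicGeometry.Resolution.ResolutionOfSingularities
import HarnessLib

/-!
# Stub `stub_regModelAt_of_trdeg_le_three` (crux stmt-ResolutionOfSingularities-0552, line `Sketch` rev. c6)

Certification stub of the skeleton `Sketch` (rev. c6) for the crux `PalterationThesis`
(stmt-ResolutionOfSingularities-0552): the residue `RegModel_K` — every function field `F/K`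
(essentially of finite type, having a proper model) has a REGULAR proper model — is a theorem in
transcendence degree `≤ 3` over every field of characteristic `p`, modulo the named fact
`CossartPiltant2019` (Cossart–Piltant 2019, Thm. 1.1: resolution of reduced separated schemes of
finite type of dimension `≤ 3` over a field). So the residue is open exactly from transcendence
degree `4`.

Proof: take a proper model `M` of `F/K`; its scheme `M.X` is integral and `M.π : M.X → Spec K`
is proper, and `dim M.X = trdeg_K F = d ≤ 3` (`properModel_topologicalKrullDim_eq_of_trdeg`,
`Theorems/PAlterationPialtAtomsOpenRange.lean`, the proper-model twin of
`ProjModel.topologicalKrullDim_eq_of_trdeg`: Görtz–Wedhorn I, Thm. 5.22 (3)); so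
`hasResolution_of_dim_le_three` resolves `M.X`, and a resolution of a proper model is a regular
proper model dominating it (`ProperModel.exists_hom_isRegular_of_hasResolution`).
-/

set_option linter.dupNamespace false

noncomputable section

open CategoryTheory AlgebraicGeometry
open Literature.AlgebraicGeometry.Resolution
open Summit.ResolutionOfSingularities.ResolutionOfSingularities.Theorems.Pialt.OpenRange
  (properModel_topologicalKrullDim_eq_of_trdeg)

namespace Summit.ResolutionOfSingularities.ResolutionOfSingularities.Theorems.PalterationThesis.ZariskiPerfect

/-- CERTIFICATION STUB (worker-sized): the residue `RegModel_K` in transcendence degree `≤ 3`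
over every field of characteristic `p`, modulo the named fact `CossartPiltant2019`
(`hasResolution_of_dim_le_three` on a proper model, whose dimension is the transcendence degree,
`properModel_topologicalKrullDim_eq_of_trdeg`, then
`ProperModel.exists_hom_isRegular_of_hasResolution`); so the residue is open exactly from
transcendence degree `4`. [cite: CossartPiltant2019, Thm. 1.1] -/
theorem stub_regModelAt_of_trdeg_le_three (hCP : CossartPiltant2019.{0}) {p : ℕ} (K : Type)
    [Field K] [CharP K p] (F : Type) [Field F] [Algebra K F] [Algebra.EssFiniteType K F]
    (d : ℕ) (hd : d ≤ 3) (htr : Algebra.trdeg K F = d) (hM : Nonempty (ProperModel K F)) :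
    ∃ N : ProperModel K F, Scheme.IsRegular N.X := by
  obtain ⟨M⟩ := hM
  have hdim : topologicalKrullDim M.X ≤ 3 := by
    rw [properModel_topologicalKrullDim_eq_of_trdeg M htr]
    exact_mod_cast hd
  obtain ⟨N, -, hN⟩ := ProperModel.exists_hom_isRegular_of_hasResolution M
    (hasResolution_of_dim_le_three (p := p) hCP K M.X M.π hdim)
  exact ⟨N, hN⟩

end Summit.ResolutionOfSingularities.ResolutionOfSingularities.Theorems.PalterationThesis.ZariskiPerfect

end
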